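import Summits.QuantumFields.YangMills.Theorems.BalabanUVNodesN15KingModelTranslationCovarianceRung
import Summits.QuantumFields.YangMills.Theorems.BalabanUVNodesN15KingModelGraphTreeDecayNE2Unit

/-!
# BalabanUVNodes ∕ N15 — THE KING-MODEL RUNG (PART Ϙ-c): TRANSLATION INVARIANCE OF KING's DIAGRAMS AT `A = 0`, AND EXACT EXTENSIVITY —
# `E^{(K)}(G) = |T^{(K)}| · E^{(K)}(G; χ_b)` FOR EVERY BLOCK `b`, HYPOTHESIS-FREE; THE TWO-LEGGED (3.56)-KERNELS DEPEND ON `b − b′` ONLY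
# (Track A, DAG node N15 = NE2; FAN-OUT v1.1 §N15 s3 «KING-MODEL RUNG … NE2's analogue DECIDED in the model»)

HONEST FRAMING.  Count-neutral (cell `pub-ymgap`, seat `pub-ymgap-dag-n15-e` g31; `--supports stmt-QuantumFields-27366 --as helper` = K3⁸
`SpineGivenEndpointR13SepCoPHV`).  TEMPLATE LITERATURE: C. King, *The U(1) Higgs model. I. The continuum limit*, Commun. Math. Phys. **102** (1986) 649–677
[King1986] — KING's OWN `A = 0` MODEL on the rung's tori.  NOT Bałaban's `G(U)`; NOT a node discharge (N15 is booked through n15-a's knit, untouched here); nothing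
continuum ∕ ℝ⁴ ∕ OS ∕ mass-gap ∕ Clay.  0 `sorry`; standard axioms.  Sequel of parts Ϙ-a∕Ϙ-b (`…TranslationCovariance{,Rung}`) and of part Β-a∕Β-c
(`…GraphTreeDecayExtensive`: the partition of unity `χ_b`, `graphValLS_unit_sum`; `…GraphTreeDecayNE2Unit`: the two-legged kernels `kingGraphPairDiff`).

THE PRINT.  p. 659 [PDF 11], after (3.35): *«Clearly E₁ is represented by a sum of vacuum energy diagrams on T_η»* — and (3.35) has the counterterm enter as
`E₁ · Σ_{x∈T^{(k)}} 1 = E₁|T^{(k)}|`: a vacuum diagram on the torus is `|T^{(k)}|` times a NUMBER, the diagram pinned at one block, the same for every block.  Part Β-a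
typed the inequality form ((3.36) inserted at a vertex ⇒ `Σ_b` of pinned diagrams, each BOUNDED uniformly in `b`); this file types the identity itself: by parts
Ϙ-a∕Ϙ-b every line kernel `G^η_K`∕`∂^η_μG^η_K` is invariant and every block indicator ∕ leg is covariant under the block translations, so the pinned diagrams are all
EQUAL (re-index the vertex sum `σ ↦ σ + L^K·v`), and the partition-of-unity sum collapses to `|T^{(K)}|` times one of them.  Likewise the two-legged (3.56)-kernels of
part Β-c (NE2's unit layer in the model, Lemma 4.5 (4.38)'s shape) depend on `b − b′` only — the toy-model shadow of the translation invariance King's §4 reads off the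
plane-wave representation (4.1)–(4.5) p. 670.

WHAT THIS FILE PROVES (kernel; 0 `def`).  §1 (generic, namespace `…Graph`) ★ `graphValLS_transl`: a graph value on a torus with translation-invariant line kernels is
unchanged when every one-vertex factor is translated (`u′_υ(x + t) = u_υ(x)`).  §2 (vacuum) ★ `king_vacuum_pinned_transl`∕`king_vacuum_pinnedHi_transl` (the diagram
pinned by `χ_{b+v}` equals the diagram pinned by `χ_b`, on `T_η` and on `T_{η′}` through the pairing), ★★★ **`king_vacuum_graph_eq_card_mul_pinned`** ∕ ★★★
**`king_vacuum_graphHi_eq_card_mul_pinned`** (`E(G) = |T^{(K)}|·E(G; χ_b)` for EVERY `b`, at level `K` and at level `K + n` — NO connectivity, NO degree hypothesis,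
any pinned vertex), ★★ `king_vacuum_graph_sub_eq_card_mul_pinned_sub` (the two-spacing difference of a vacuum diagram IS `|T^{(K)}|` times ONE pinned two-spacing
difference — the exact form of part Β-a's mechanism).  §3 (legs) ★ `king_graph_legsLo_transl`∕`king_graph_legsHi_transl` (translating all the legs' unit sites leaves
the diagram unchanged, coarse and fine legs), `vecCons_add_const`, ★★ **`kingGraphPairDiff_transl`** (part Β-c's two-legged (3.56)-kernel satisfies
`k(b + v, b′ + v) = k(b, b′)`) and ★★ `kingGraphUnit_transl` (so does NE2's unit-layer `SiteKernel` of the model).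

HONEST SCOPE.  Torus ∕ periodic b.c., flat block mean, `A = 0` (part Ϙ-a HONEST SCOPE).  The identities hold for EVERY numbered graph and all parameters (they are
algebra, not estimates); the estimates remain those of parts Α∕Β.  N15 untouched; counts unmoved.
Locators: [King1986] (2.10)–(2.15) pp.652–653, (3.35) p.659, (3.36)–(3.37) p.660, Prop. 3.6 (3.56) p.662, p.663, Prop. 3.8 (3.71) p.664, (4.1)–(4.5) p.670, Lemma 4.5 (4.38) p.674.
-/

noncomputable section

open scoped BigOperators
open Finset Matrix

/-! ## §1 Generic: translating every one-vertex factor of a diagram with translation-invariant lines -/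

namespace Summit.QuantumFields.YangMills.BalabanUVNodes.N15KingModelRung.Graph

open Literature.MathematicalPhysics.QuantumFieldTheory.Balaban1983to89.B5Prop11Plancherel (Tor)

section Transl

variable {V Λ Υ : Type*} [Fintype V] [DecidableEq V] [Fintype Λ] [Fintype Υ] {𝕂 : Type*} [CommSemiring 𝕂]
  {d' : ℕ} {N : Fin d' → ℕ} [∀ μ, NeZero (N μ)]

/-- ★ **A DIAGRAM WITH TRANSLATION-INVARIANT LINES IS UNCHANGED WHEN ALL ITS ONE-VERTEX FACTORS ARE TRANSLATED**: if `G_ℓ(x + t, y + t) = G_ℓ(x, y)` for every line and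
`u′_υ(x + t) = u_υ(x)` for every one-vertex factor, then `E(G; u′) = E(G; u)` (re-index the vertex assignments `σ ↦ σ + t`). [cite: King1986, (3.55)–(3.59) pp.662–663, (4.1) p.670] -/
theorem graphValLS_transl (w : 𝕂) (src tgt : Λ → V) (G : Λ → Tor N → Tor N → 𝕂) (vtx : Υ → V) (u u' : Υ → Tor N → 𝕂) (t : Tor N)
    (hG : ∀ ℓ x y, G ℓ (x + t) (y + t) = G ℓ x y) (hu : ∀ υ x, u' υ (x + t) = u υ x) :
    graphValLS w src tgt G vtx u' = graphValLS w src tgt G vtx u := by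
  unfold graphValLS
  calc ∑ σ : V → Tor N, w ^ Fintype.card V * ((∏ ℓ, G ℓ (σ (src ℓ)) (σ (tgt ℓ))) * ∏ υ, u' υ (σ (vtx υ)))
      = ∑ σ : V → Tor N, w ^ Fintype.card V
          * ((∏ ℓ, G ℓ ((σ + fun (_ : V) => t) (src ℓ)) ((σ + fun (_ : V) => t) (tgt ℓ)))
            * ∏ υ, u' υ ((σ + fun (_ : V) => t) (vtx υ))) :=
        (Fintype.sum_equiv (Equiv.addRight (fun _ : V => t)) _ _ fun _ => rfl).symm
    _ = ∑ σ : V → Tor N, w ^ Fintype.card V * ((∏ ℓ, G ℓ (σ (src ℓ)) (σ (tgt ℓ))) * ∏ υ, u υ (σ (vtx υ))) :=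
        Finset.sum_congr rfl fun σ _ => by simp only [Pi.add_apply, hG, hu]

end Transl

end Summit.QuantumFields.YangMills.BalabanUVNodes.N15KingModelRung.Graph

namespace Summit.QuantumFields.YangMills.BalabanUVNodes.N15KingModelRung.Curved

open Literature.MathematicalPhysics.QuantumFieldTheory.Balaban1983to89.B5Prop11Plancherel (Tor fine)
open Literature.MathematicalPhysics.QuantumFieldTheory.Balaban1983to89 (B5Block118.up B5Block118.up_add)
open Literature.MathematicalPhysics.QuantumFieldTheory.King1986.Torus
open Summit.QuantumFields.YangMills.BalabanUVNodes.N15KingModelRung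
open Summit.QuantumFields.YangMills.BalabanUVNodes.N15KingModelRung.Transl
open Summit.QuantumFields.YangMills.BalabanUVNodes.N15KingModelRung.Graph

variable {d : ℕ} (L : ℕ) [NeZero L]

/-! ## §2 Vacuum diagrams: the pinned diagram does not depend on the block; EXACT extensivity -/

section Vacuum

variable (a msq : ℝ) (jv : KingVolIndex d) {nn m : ℕ} (src tgt : Fin m → Fin (nn + 1)) (κ : Fin m → Option (Fin (d + 1))) (v₀ : Fin (nn + 1))

/-- ★ **THE DIAGRAM PINNED BY `χ_{b+v}` EQUALS THE DIAGRAM PINNED BY `χ_b`** (level `K`, any pinned vertex `v₀`). [cite: King1986, (3.35) p.659, (3.36)–(3.37) p.660] -/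
theorem king_vacuum_pinned_transl (b₀ v : Tor (kingVol L jv)) :
    haveI := kingVol_neZero L jv
    graphValLS ((((L : ℝ) ^ jv.K)⁻¹) ^ (d + 1)) src tgt (fun ℓ => kingGLine L (kingVol L jv) a msq jv.K (κ ℓ)) (fun _ : Unit => v₀)
        (fun _ => blockIndLo L jv (b₀ + v))
      = graphValLS ((((L : ℝ) ^ jv.K)⁻¹) ^ (d + 1)) src tgt (fun ℓ => kingGLine L (kingVol L jv) a msq jv.K (κ ℓ)) (fun _ : Unit => v₀)
        (fun _ => blockIndLo L jv b₀) := by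
  haveI := kingVol_neZero L jv
  exact graphValLS_transl _ _ _ _ _ _ _ (B5Block118.up (L ^ jv.K) (kingVol L jv) v)
    (fun ℓ x y => kingGLine_transl L (kingVol L jv) a msq jv.K (κ ℓ) x y v) (fun _ x => blockIndLo_transl L jv b₀ v x)

/-- ★ **… and on `T_{η′}`** (level `K + n`, indicator read through the pairing). [cite: King1986, (3.35) p.659, (3.36)–(3.37) p.660, p.664 (pairing)] -/
theorem king_vacuum_pinnedHi_transl (n : ℕ) (b₀ v : Tor (kingVol L jv)) :
    haveI := kingVol_neZero L jv
    graphValLS ((((L : ℝ) ^ (jv.K + n))⁻¹) ^ (d + 1)) src tgt (fun ℓ => kingGLine L (kingVol L jv) a msq (jv.K + n) (κ ℓ)) (fun _ : Unit => v₀)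
        (fun _ => blockIndHi L jv n (b₀ + v))
      = graphValLS ((((L : ℝ) ^ (jv.K + n))⁻¹) ^ (d + 1)) src tgt (fun ℓ => kingGLine L (kingVol L jv) a msq (jv.K + n) (κ ℓ)) (fun _ : Unit => v₀)
        (fun _ => blockIndHi L jv n b₀) := by
  haveI := kingVol_neZero L jv
  exact graphValLS_transl _ _ _ _ _ _ _ (B5Block118.up (L ^ (jv.K + n)) (kingVol L jv) v)
    (fun ℓ x y => kingGLine_transl L (kingVol L jv) a msq (jv.K + n) (κ ℓ) x y v) (fun _ x => blockIndHi_transl L jv n b₀ v x)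

/-- ★★★ **EXACT EXTENSIVITY OF VACUUM DIAGRAMS AT `A = 0`, HYPOTHESIS-FREE**: `E^{(K)}(G) = |T^{(K)}| · E^{(K)}(G; χ_{b₀})` for EVERY block `b₀` — the leg-free diagram
(trivial factor `1` at the vertex `v₀`) is the unit-torus volume times the diagram pinned at ANY one block (partition of unity (3.36) + all pinned diagrams equal). [cite: King1986, (3.35) p.659 («E₁ is represented by a sum of vacuum energy diagrams»; `E₁·|T^{(k)}|`), (3.36)–(3.37) p.660] -/
theorem king_vacuum_graph_eq_card_mul_pinned (b₀ : Tor (kingVol L jv)) :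
    haveI := kingVol_neZero L jv
    graphValLS ((((L : ℝ) ^ jv.K)⁻¹) ^ (d + 1)) src tgt (fun ℓ => kingGLine L (kingVol L jv) a msq jv.K (κ ℓ)) (fun _ : Unit => v₀)
        (fun _ _ => (1 : ℝ))
      = (Fintype.card (Tor (kingVol L jv)) : ℝ) *
        graphValLS ((((L : ℝ) ^ jv.K)⁻¹) ^ (d + 1)) src tgt (fun ℓ => kingGLine L (kingVol L jv) a msq jv.K (κ ℓ)) (fun _ : Unit => v₀)
          (fun _ => blockIndLo L jv b₀) := by
  haveI := kingVol_neZero L jv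
  have h1 : (fun (_ : Unit) (_ : Tor (fine (L ^ jv.K) (kingVol L jv))) => (1 : ℝ))
      = fun (_ : Unit) (x : Tor (fine (L ^ jv.K) (kingVol L jv))) => ∑ b ∈ (univ : Finset (Tor (kingVol L jv))), blockIndLo L jv b x := by
    funext _ x; rw [sum_blockIndLo_eq_one]
  rw [h1, graphValLS_unit_sum]
  have hconst : ∀ b : Tor (kingVol L jv),
      graphValLS ((((L : ℝ) ^ jv.K)⁻¹) ^ (d + 1)) src tgt (fun ℓ => kingGLine L (kingVol L jv) a msq jv.K (κ ℓ)) (fun _ : Unit => v₀)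
          (fun _ => blockIndLo L jv b)
        = graphValLS ((((L : ℝ) ^ jv.K)⁻¹) ^ (d + 1)) src tgt (fun ℓ => kingGLine L (kingVol L jv) a msq jv.K (κ ℓ)) (fun _ : Unit => v₀)
          (fun _ => blockIndLo L jv b₀) := fun b => by
    have h := king_vacuum_pinned_transl L a msq jv src tgt κ v₀ b₀ (b - b₀)
    rwa [add_sub_cancel] at h
  rw [Finset.sum_congr rfl fun b _ => hconst b, Finset.sum_const, Finset.card_univ, nsmul_eq_mul]

/-- ★★★ **… AND AT LEVEL `K + n`**: `E^{(K+n)}(G) = |T^{(K)}| · E^{(K+n)}(G; χ_{b₀})` (indicators through the pairing). [cite: King1986, (3.35) p.659, (3.36)–(3.37) p.660, p.664] -/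
theorem king_vacuum_graphHi_eq_card_mul_pinned (n : ℕ) (b₀ : Tor (kingVol L jv)) :
    haveI := kingVol_neZero L jv
    graphValLS ((((L : ℝ) ^ (jv.K + n))⁻¹) ^ (d + 1)) src tgt (fun ℓ => kingGLine L (kingVol L jv) a msq (jv.K + n) (κ ℓ)) (fun _ : Unit => v₀)
        (fun _ _ => (1 : ℝ))
      = (Fintype.card (Tor (kingVol L jv)) : ℝ) *
        graphValLS ((((L : ℝ) ^ (jv.K + n))⁻¹) ^ (d + 1)) src tgt (fun ℓ => kingGLine L (kingVol L jv) a msq (jv.K + n) (κ ℓ)) (fun _ : Unit => v₀)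
          (fun _ => blockIndHi L jv n b₀) := by
  haveI := kingVol_neZero L jv
  have h1 : (fun (_ : Unit) (_ : Tor (fine (L ^ (jv.K + n)) (kingVol L jv))) => (1 : ℝ))
      = fun (_ : Unit) (x' : Tor (fine (L ^ (jv.K + n)) (kingVol L jv))) => ∑ b ∈ (univ : Finset (Tor (kingVol L jv))), blockIndHi L jv n b x' := by
    funext _ x'; rw [sum_blockIndHi_eq_one]
  rw [h1, graphValLS_unit_sum]
  have hconst : ∀ b : Tor (kingVol L jv),
      graphValLS ((((L : ℝ) ^ (jv.K + n))⁻¹) ^ (d + 1)) src tgt (fun ℓ => kingGLine L (kingVol L jv) a msq (jv.K + n) (κ ℓ)) (fun _ : Unit => v₀)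
          (fun _ => blockIndHi L jv n b)
        = graphValLS ((((L : ℝ) ^ (jv.K + n))⁻¹) ^ (d + 1)) src tgt (fun ℓ => kingGLine L (kingVol L jv) a msq (jv.K + n) (κ ℓ)) (fun _ : Unit => v₀)
          (fun _ => blockIndHi L jv n b₀) := fun b => by
    have h := king_vacuum_pinnedHi_transl L a msq jv src tgt κ v₀ n b₀ (b - b₀)
    rwa [add_sub_cancel] at h
  rw [Finset.sum_congr rfl fun b _ => hconst b, Finset.sum_const, Finset.card_univ, nsmul_eq_mul]

/-- ★★ **THE TWO-SPACING DIFFERENCE OF A VACUUM DIAGRAM IS `|T^{(K)}|` TIMES ONE PINNED TWO-SPACING DIFFERENCE** — the EXACT form of the mechanism behind part Β-a's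
`king_vacuum_graph_rate_extensive` ((3.36) at a vertex ⇒ (3.9)'s `C L^{−γk}|T|`): `E^{(K+n)}(G) − E^{(K)}(G) = |T^{(K)}|·(E^{(K+n)}(G; χ_{b₀}) − E^{(K)}(G; χ_{b₀}))`.
[cite: King1986, Thm 3.4 (3.9) p.656, (3.35) p.659, (3.36)–(3.37) p.660] -/
theorem king_vacuum_graph_sub_eq_card_mul_pinned_sub (n : ℕ) (b₀ : Tor (kingVol L jv)) :
    haveI := kingVol_neZero L jv
    graphValLS ((((L : ℝ) ^ (jv.K + n))⁻¹) ^ (d + 1)) src tgt (fun ℓ => kingGLine L (kingVol L jv) a msq (jv.K + n) (κ ℓ)) (fun _ : Unit => v₀)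
          (fun _ _ => (1 : ℝ))
        - graphValLS ((((L : ℝ) ^ jv.K)⁻¹) ^ (d + 1)) src tgt (fun ℓ => kingGLine L (kingVol L jv) a msq jv.K (κ ℓ)) (fun _ : Unit => v₀)
          (fun _ _ => (1 : ℝ))
      = (Fintype.card (Tor (kingVol L jv)) : ℝ) *
        (graphValLS ((((L : ℝ) ^ (jv.K + n))⁻¹) ^ (d + 1)) src tgt (fun ℓ => kingGLine L (kingVol L jv) a msq (jv.K + n) (κ ℓ)) (fun _ : Unit => v₀)
            (fun _ => blockIndHi L jv n b₀)
          - graphValLS ((((L : ℝ) ^ jv.K)⁻¹) ^ (d + 1)) src tgt (fun ℓ => kingGLine L (kingVol L jv) a msq jv.K (κ ℓ)) (fun _ : Unit => v₀)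
            (fun _ => blockIndLo L jv b₀)) := by
  rw [king_vacuum_graphHi_eq_card_mul_pinned L a msq jv src tgt κ v₀ n b₀, king_vacuum_graph_eq_card_mul_pinned L a msq jv src tgt κ v₀ b₀, mul_sub]

end Vacuum

/-! ## §3 Diagrams with legs: translating every leg's unit site; the two-legged (3.56)-kernels depend on `b − b′` only -/

section Legs

variable (a msq : ℝ) (jv : KingVolIndex d) {nn m : ℕ} (src tgt : Fin m → Fin (nn + 1)) (κ : Fin m → Option (Fin (d + 1)))

/-- ★ **TRANSLATING ALL THE LEGS' UNIT SITES LEAVES THE DIAGRAM UNCHANGED** (coarse legs `ℋ_K`∕`∂ℋ_K`, any weight `w`, any leg family). [cite: King1986, Prop. 3.6 (3.56) p.662, Prop. 3.8 (3.71) p.664, (4.1)–(4.2) p.670] -/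
theorem king_graph_legsLo_transl (w : ℝ) {Υ : Type*} [Fintype Υ] (vtx : Υ → Fin (nn + 1)) (b : Υ → Tor (kingVol L jv))
    (κe : Υ → Option (Fin (d + 1))) (v : Tor (kingVol L jv)) :
    haveI := kingVol_neZero L jv
    graphValLS w src tgt (fun ℓ => kingGLine L (kingVol L jv) a msq jv.K (κ ℓ)) vtx (fun υ => kingExtLo L a msq jv (b υ + v) (κe υ))
      = graphValLS w src tgt (fun ℓ => kingGLine L (kingVol L jv) a msq jv.K (κ ℓ)) vtx (fun υ => kingExtLo L a msq jv (b υ) (κe υ)) := by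
  haveI := kingVol_neZero L jv
  exact graphValLS_transl _ _ _ _ _ _ _ (B5Block118.up (L ^ jv.K) (kingVol L jv) v)
    (fun ℓ x y => kingGLine_transl L (kingVol L jv) a msq jv.K (κ ℓ) x y v) (fun υ x => kingExtLo_transl L a msq jv (b υ) v (κe υ) x)

/-- ★ **… and for the fine legs `ℋ_{K+n}`∕`∂ℋ_{K+n}` at level `K + n`.** [cite: King1986, Prop. 3.6 (3.56) p.662, Prop. 3.8 (3.71) p.664] -/
theorem king_graph_legsHi_transl (w : ℝ) (n : ℕ) {Υ : Type*} [Fintype Υ] (vtx : Υ → Fin (nn + 1)) (b : Υ → Tor (kingVol L jv))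
    (κe : Υ → Option (Fin (d + 1))) (v : Tor (kingVol L jv)) :
    haveI := kingVol_neZero L jv
    graphValLS w src tgt (fun ℓ => kingGLine L (kingVol L jv) a msq (jv.K + n) (κ ℓ)) vtx (fun υ => kingExtHi L a msq jv n (b υ + v) (κe υ))
      = graphValLS w src tgt (fun ℓ => kingGLine L (kingVol L jv) a msq (jv.K + n) (κ ℓ)) vtx (fun υ => kingExtHi L a msq jv n (b υ) (κe υ)) := by
  haveI := kingVol_neZero L jv
  exact graphValLS_transl _ _ _ _ _ _ _ (B5Block118.up (L ^ (jv.K + n)) (kingVol L jv) v)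
    (fun ℓ x y => kingGLine_transl L (kingVol L jv) a msq (jv.K + n) (κ ℓ) x y v) (fun υ x => kingExtHi_transl L a msq jv n (b υ) v (κe υ) x)

omit [NeZero L] in
/-- `![b + v, b′ + v] = ![b, b′] + v` (translating a pair of leg sites). [folklore] -/
theorem vecCons_add_const {α : Type*} [Add α] (b b' v : α) : (![b + v, b' + v] : Fin 2 → α) = fun υ => ![b, b'] υ + v := by
  funext υ
  fin_cases υ <;> rfl

/-- ★★ **THE TWO-LEGGED (3.56)-KERNEL OF PART Β-c DEPENDS ON `b − b′` ONLY**: `k(b + v, b′ + v) = k(b, b′)` — NE2's unit-layer kernel in King's model (Lemma 4.5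
(4.38)'s shape, `kingGraphPairDiff`) is translation invariant on `T^{(K)}`. [cite: King1986, Prop. 3.6 (3.56) p.662, Lemma 4.5 (4.38) p.674, (4.1)–(4.5) p.670] -/
theorem kingGraphPairDiff_transl (n : ℕ) (v₁ : Fin (nn + 1)) (κ₀ κ₁ : Option (Fin (d + 1))) (b b' v : Tor (kingVol L jv)) :
    kingGraphPairDiff L a msq jv n nn m src tgt κ v₁ κ₀ κ₁ (b + v) (b' + v) = kingGraphPairDiff L a msq jv n nn m src tgt κ v₁ κ₀ κ₁ b b' := by
  unfold kingGraphPairDiff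
  rw [vecCons_add_const]
  exact congrArg₂ (· - ·) (king_graph_legsHi_transl L a msq jv src tgt κ _ n ![(0 : Fin (nn + 1)), v₁] ![b, b'] ![κ₀, κ₁] v)
    (king_graph_legsLo_transl L a msq jv src tgt κ _ ![(0 : Fin (nn + 1)), v₁] ![b, b'] ![κ₀, κ₁] v)

/-- ★★ **… hence NE2's UNIT-LAYER `SiteKernel` OF THE MODEL** (part Β-c `kingGraphUnit`, on the family `kingVolInstance d L`) **IS TRANSLATION INVARIANT**:
`k_j(U; b + v, b′ + v) = k_j(U; b, b′)` at every index and (the unique) background. [cite: King1986, Prop. 3.6 (3.56) p.662, Lemma 4.5 (4.38) p.674] -/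
theorem kingGraphUnit_transl (n : ℕ) (v₁ : Fin (nn + 1)) (κ₀ κ₁ : Option (Fin (d + 1))) (j : KingVolIndex d)
    (U : (kingVolInstance d L j).Bf.Cfg) (b b' v : Tor (kingVol L j)) :
    (kingGraphUnit L a msq n nn m src tgt κ v₁ κ₀ κ₁ j).ker U (b + v) (b' + v) = (kingGraphUnit L a msq n nn m src tgt κ v₁ κ₀ κ₁ j).ker U b b' :=
  kingGraphPairDiff_transl L a msq j src tgt κ n v₁ κ₀ κ₁ b b' v

end Legs

end Summit.QuantumFields.YangMills.BalabanUVNodes.N15KingModelRung.Curved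

end
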